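import Summits.QuantumFields.YangMills.Theorems.ColdStartUniversalityUniformColdStartMixingDictionary
import Literature.MathematicalPhysics.QuantumFieldTheory.Balaban1983to89.T4GenFunBounds
import Literature.MathematicalPhysics.QuantumFieldTheory.LatticeGaugeProofs
import HarnessLib

/-!
# Route `ColdStartUniversality`, cruxes K_A1/K_A2 (stmt-QuantumFields-24809/24810): regularity of the Cesàro
# integrand `s ↦ E[∏ avgObs (U(s/ε_K))]` along ANY cold-start solution

Helper file (lead `ym-line-csu-p1`, rung plumbing for `stub_fixedCutoffMixing`; it is also, verbatim, the
planner's registered stub `stub_integrandRegular` of K_A2 `ColdStartContinuumCauchy` and of the birth skeleton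
of K_A1).  For every admissible `F`, `γ > 0`, loop string `os`, step `K` and every cold-start solution `U` of
the SZZ dynamics at `β' = (γ ε_K)⁻¹/2` on any filtered probability space:

* `|expectAt K os| ≤ 1` — by the Gibbs dictionary (`expectAt_eq_integral_wilsonMeasure`, p604374) and
  `|∏ avgObs| ≤ 1` under the probability measure `wilsonMeasure` (`isProbabilityMeasure_wilsonMeasure`);
* `|E[∏ avgObs (U(s/ε_K))]| ≤ 1` for every real `s`;
* `s ↦ E[∏ avgObs (U(s/ε_K))]` is interval-integrable on every `[0, T]`: it is bounded by `1` and MEASURABLE —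
  the solution has a.s. continuous paths and measurable marginals, so after modification on a null set
  (`U ↦ 1` there; expectations unchanged) it has continuous paths everywhere, hence is jointly measurable in
  `(t, ω)` (Mathlib `measurable_uncurry_of_continuous_of_measurable`), and Fubini measurability
  (`StronglyMeasurable.integral_prod_right`) applies to the bounded measurable observable.

`integrandRegular` is the registered signature verbatim (LatticeRep literal, `hW.natFiltration`).  No definition,
no sorry, standard axioms.  RECORD-rung plumbing; NOT K_A1/K_A2, not the mass gap.
-/

set_option autoImplicit false

noncomputable section

namespace Summit.QuantumFields.YangMills.Theorems.ColdStartUniversality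

open MeasureTheory ProbabilityTheory intervalIntegral Filter Topology
open scoped NNReal
open Literature.MathematicalPhysics.QuantumFieldTheory
open Literature.MathematicalPhysics.QuantumLattice (fundamentalRep fundamentalLatticeRep continuous_fundamentalRep)
open Literature.MathematicalPhysics.QuantumFieldTheory.Balaban1983to89

/-- **A process with measurable marginals and a.s. continuous paths has a jointly measurable modification**
(agreeing with it off a null set): modify it to the constant configuration `1` on a measurable null set
containing the discontinuous paths; the modified process has continuous paths everywhere and measurable
marginals, hence `(t, ω) ↦ Ũ t ω` is measurable (Mathlib `measurable_uncurry_of_continuous_of_measurable`).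
[folklore] -/
theorem exists_null_modification_measurable_uncurry {Ω : Type*} {mΩ : MeasurableSpace Ω} {P : Measure Ω}
    {L : ℕ} [NeZero L] {U : ℝ≥0 → Ω → GaugeConfig 3 L (Matrix.specialUnitaryGroup (Fin 2) ℂ)}
    (hm : ∀ t, Measurable (U t)) (hc : ∀ᵐ ω ∂P, Continuous fun t => U t ω) :
    ∃ (N : Set Ω) (Ut : ℝ≥0 → Ω → GaugeConfig 3 L (Matrix.specialUnitaryGroup (Fin 2) ℂ)),
      MeasurableSet N ∧ P N = 0 ∧ (∀ ω, ω ∉ N → ∀ t, Ut t ω = U t ω) ∧ Measurable (Function.uncurry Ut) := by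
  classical
  rw [ae_iff] at hc
  obtain ⟨N, hsub, hN, hN0⟩ := exists_measurable_superset_of_null hc
  refine ⟨N, fun t ω => if ω ∈ N then (fun _ => 1) else U t ω, hN, hN0, fun ω hω t => by simp [hω], ?_⟩
  haveI : SecondCountableTopology (Matrix (Fin 2) (Fin 2) ℂ) :=
    inferInstanceAs (SecondCountableTopology (Fin 2 → Fin 2 → ℂ))
  haveI : SecondCountableTopology (Matrix.specialUnitaryGroup (Fin 2) ℂ) :=
    Topology.IsEmbedding.subtypeVal.secondCountableTopology
  refine measurable_uncurry_of_continuous_of_measurable (fun ω => ?_) (fun t => ?_)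
  · by_cases hω : ω ∈ N
    · simp only [hω, if_true]; exact continuous_const
    · simp only [hω, if_false]
      exact Classical.by_contradiction fun h => hω (hsub h)
  · exact Measurable.ite hN measurable_const (hm t)

/-- **Regularity of the Cesàro integrand along a cold-start solution** — the registered stub
`stub_integrandRegular` of the route's cruxes, verbatim: `|expectAt K os| ≤ 1`,
`|E[∏_{C∈os} avgObs K C (U(s/ε_K))]| ≤ 1` for all `s`, and interval-integrability of
`s ↦ E[∏ avgObs (U(s/ε_K))]` on every `[0, T]`. -/
theorem integrandRegular :
    ∀ (F : T3ContinuumYM3Torus.T3Family) (γ : ℝ), 0 < γ → ∀ (os : List (T3ContinuumYM3Torus.ULoop3 F)) (K : ℕ)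
      (Ω : Type) (mΩ : MeasurableSpace Ω) (P : Measure Ω) (hP : IsProbabilityMeasure P)
      (W : ℝ≥0 → Ω → (Edge 3 ((F.P K).sitesPerDir 0) × NoiseIdx 2 → ℝ)) (hW : IsFlatBrownian W P)
      (U : ℝ≥0 → Ω → GaugeConfig 3 ((F.P K).sitesPerDir 0) (Matrix.specialUnitaryGroup (Fin 2) ℂ)),
      (∀ ω, U 0 ω = fun _ => 1) →
      (latticeLangevinDynamics (⟨2, Literature.MathematicalPhysics.QuantumLattice.fundamentalRep (Fin 2),
          Literature.MathematicalPhysics.QuantumLattice.continuous_fundamentalRep _,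
          Literature.MathematicalPhysics.QuantumLattice.fundamentalRep_injective _,
          Literature.MathematicalPhysics.QuantumLattice.fundamentalRep_mem_unitaryGroup⟩ :
          LatticeRep (Matrix.specialUnitaryGroup (Fin 2) ℂ)) ((γ * (F.P K).eps)⁻¹ / 2)).IsSolution
        (Literature.MathematicalPhysics.QuantumLattice.fundamentalRep (Fin 2)) hW.natFiltration P W U →
      |(F.scheme (ExpMeanLog.expMeanLogSU : LoopAverage (Matrix.specialUnitaryGroup (Fin 2) ℂ)) γ).expectAt K os| ≤ 1 ∧
        (∀ s : ℝ, |∫ ω, (os.map fun C => F.avgObs (ExpMeanLog.expMeanLogSU :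
            LoopAverage (Matrix.specialUnitaryGroup (Fin 2) ℂ)) K C
          (fun b : PBond (F.P K) 0 => U (s / (F.P K).eps).toNNReal ω (b.src, b.dir))).prod ∂P| ≤ 1) ∧
        ∀ T : ℝ, IntervalIntegrable (fun s : ℝ => ∫ ω, (os.map fun C => F.avgObs (ExpMeanLog.expMeanLogSU :
            LoopAverage (Matrix.specialUnitaryGroup (Fin 2) ℂ)) K C
          (fun b : PBond (F.P K) 0 => U (s / (F.P K).eps).toNNReal ω (b.src, b.dir))).prod ∂P) volume 0 T := by
  intro F γ _hγ os K Ω mΩ P hP W hW U _hU0 hsol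
  -- the observable read through the bond dictionary
  set f : GaugeConfig 3 ((F.P K).sitesPerDir 0) (Matrix.specialUnitaryGroup (Fin 2) ℂ) → ℝ :=
    fun V => (os.map fun C => F.avgObs (ExpMeanLog.expMeanLogSU :
        LoopAverage (Matrix.specialUnitaryGroup (Fin 2) ℂ)) K C
      (fun b : PBond (F.P K) 0 => V (b.src, b.dir))).prod with hf
  have hfm : Measurable f := by
    have hm : ∀ K' C, Measurable ((F.scheme (ExpMeanLog.expMeanLogSU :
        LoopAverage (Matrix.specialUnitaryGroup (Fin 2) ℂ)) 1).obs K' C) := fun K' C =>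
      F.measurable_avgObs (F.avgMeasurable_of_measurableE _ T4ApexTwoLevel.measurableE_expMeanLogSU) K' C
    have hΦ : Measurable fun V : GaugeConfig 3 ((F.P K).sitesPerDir 0) (Matrix.specialUnitaryGroup (Fin 2) ℂ) =>
        (fun b : PBond (F.P K) 0 => V (b.src, b.dir) : GaugeField (F.P K) 0 (Matrix.specialUnitaryGroup (Fin 2) ℂ)) :=
      measurable_pi_lambda _ fun b => measurable_pi_apply _
    exact (T4GenFunBounds.measurable_prodObs _ hm K os).comp hΦ
  have hfb : ∀ V, |f V| ≤ 1 := fun V =>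
    T4GenFunBounds.abs_prodObs_le_one
      (F.scheme (ExpMeanLog.expMeanLogSU : LoopAverage (Matrix.specialUnitaryGroup (Fin 2) ℂ)) 1)
      (fun K' C U => F.abs_avgObs_le_one _ K' C U) K os _
  have hfn : ∀ V, ‖f V‖ ≤ 1 := fun V => by rw [Real.norm_eq_abs]; exact hfb V
  refine ⟨?_, fun s => ?_, fun T => ?_⟩
  · -- |expectAt| ≤ 1 via the Gibbs dictionary
    rw [expectAt_eq_integral_wilsonMeasure]
    haveI := isProbabilityMeasure_wilsonMeasure (d := 3) (L := (F.P K).sitesPerDir 0)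
      (G := Matrix.specialUnitaryGroup (Fin 2) ℂ) (fundamentalRep (Fin 2)) (continuous_fundamentalRep (Fin 2))
      ((γ * (F.P K).eps)⁻¹ / 2)
    have h := norm_integral_le_of_norm_le_const (μ := wilsonMeasure (d := 3) (L := (F.P K).sitesPerDir 0)
      (fundamentalRep (Fin 2)) ((γ * (F.P K).eps)⁻¹ / 2)) (ae_of_all _ hfn)
    rw [Real.norm_eq_abs, probReal_univ, mul_one] at h
    exact h
  · -- |E f(U_{s/ε})| ≤ 1
    have h := norm_integral_le_of_norm_le_const (μ := P) (ae_of_all _ fun ω => hfn (U (s / (F.P K).eps).toNNReal ω))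
    rw [Real.norm_eq_abs, probReal_univ, mul_one] at h
    exact h
  · -- interval integrability: bounded and measurable (after a null modification of `U`)
    have hmU : ∀ t, Measurable (U t) := fun t => (hsol.adapted t).mono (hW.natFiltration.le t) le_rfl
    obtain ⟨N, Ut, hN, hN0, hUt, hunc⟩ := exists_null_modification_measurable_uncurry hmU hsol.continuous
    -- the modified integrand is jointly measurable
    have hjoint : Measurable (Function.uncurry fun (s : ℝ) (ω : Ω) => f (Ut (s / (F.P K).eps).toNNReal ω)) := by
      have h1 : Measurable fun p : ℝ × Ω => ((p.1 / (F.P K).eps).toNNReal, p.2) :=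
        ((measurable_fst.div_const _).real_toNNReal).prodMk measurable_snd
      exact hfm.comp (hunc.comp h1)
    have hgm : StronglyMeasurable fun s : ℝ => ∫ ω, f (Ut (s / (F.P K).eps).toNNReal ω) ∂P :=
      StronglyMeasurable.integral_prod_right (hjoint.stronglyMeasurable)
    -- the modification does not change expectations
    have hae : ∀ s : ℝ, (∫ ω, f (Ut (s / (F.P K).eps).toNNReal ω) ∂P) = ∫ ω, f (U (s / (F.P K).eps).toNNReal ω) ∂P := by
      intro s
      refine integral_congr_ae ?_
      have hNae : ∀ᵐ ω ∂P, ω ∉ N := by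
        rw [ae_iff]; simpa using hN0
      filter_upwards [hNae] with ω hω
      rw [hUt ω hω]
    have hgm' : AEStronglyMeasurable (fun s : ℝ => ∫ ω, f (U (s / (F.P K).eps).toNNReal ω) ∂P)
        (volume.restrict (Set.uIoc 0 T)) := by
      have : (fun s : ℝ => ∫ ω, f (U (s / (F.P K).eps).toNNReal ω) ∂P) =
          fun s : ℝ => ∫ ω, f (Ut (s / (F.P K).eps).toNNReal ω) ∂P := funext fun s => (hae s).symm
      rw [this]
      exact hgm.aestronglyMeasurable
    rw [intervalIntegrable_iff]
    refine Integrable.mono' (g := fun _ => (1 : ℝ)) ?_ hgm' (ae_of_all _ fun s => ?_)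
    · exact integrableOn_const (by simp [Real.volume_uIoc])
    · have h := norm_integral_le_of_norm_le_const (μ := P)
        (ae_of_all _ fun ω => hfn (U (s / (F.P K).eps).toNNReal ω))
      rw [probReal_univ, mul_one] at h
      exact h

end Summit.QuantumFields.YangMills.Theorems.ColdStartUniversality

end
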